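import Literature.IUT.LogVolume.Corollary22PartIILemmas
import Literature.IUT.LogVolume.Corollary22Arithmetic
import Literature.IUT.LogVolume.Corollary22PrimeChoice
import Literature.IUT.LogVolume.Corollary22OfPartII
import Literature.NumberTheory.DiophantineGeometry.GenEllNorthcottProofs
import HarnessLib

/-!
# [IUTchIV] Corollary 2.2 (ii) — PROVED as an assembly from the two named interfaces `Thm110Legendre`
# (what the proof takes from Theorem 1.10) and `FullGaloisImage` ([GenEll] §3, classical)

Mochizuki, *Inter-universal Teichmüller theory IV*, RIMS manuscript (Apr. 2020; = PRIMS **57** (2021)),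
Cor. 2.2 (ii), statement pp. 41–43, proof pp. 43–48. This file kernel-checks the PROOF of (ii) (p. 43
"Next, we consider assertion (ii)" through p. 48 "This completes the proof of assertion (ii)") as typed in
`Corollary22Statement.lean` (`Cor22.PartII D H_unif`), for every compactly bounded `K_V` satisfying the
hypotheses of Cor. 2.2, from exactly the two named inputs of `Corollary22Legendre.lean`:

* `Cor22.Thm110Legendre` — "(P7) … In light of (P7), we may apply Theorem 1.10" (p. 46): the ONLY place
  where the disputed chain ([IUTchIII] Cor. 3.12 ⇒ Thm. 1.10) enters; a HYPOTHESIS, never asserted;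
* `Cor22.FullGaloisImage` — the passage (P4) ⇒ (P6) of pp. 45–46 ([GenEll] Lemma 3.5, Prop. 3.4, Lemma 3.1
  (iii), the Tate curve), CLASSICAL; a hypothesis here, dischargeable in the tree.

All the rest of the printed proof is PROVED here or in the tree: the choice of the prime `l` with (P1)–(P3)
(`PrimeChoiceData.exists_prime_P1_P2_P3`, Prop. 2.1), the arithmetic pp. 46–48 (`Cor22.Data.condition_C2`,
`h_lt_of_one_lt_epsE`), Cor. 2.2 (i) (`partI_holds`, giving `B_K` and the height comparison), and each
"this implies that there is only a finite number of possibilities for the `j`-invariant of `E_F`" (pp. 43,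
44, 46, 47) — realised as ONE exceptional set `Exc_d := {x ∈ K_V ∩ U_X(ℚ̄)^{≤d} : log(q^∀(x)) ≤
H_unif·ε_d^{−3}·d^{4+ε_d} + H_K}` (finite by [GenEll] Prop. 1.4 (iv) = Northcott, `northcott_UPle_holds`,
through (i): `ht ≲ (1/6)·log(q^∀)` on `K_V`), into which the exclusions are absorbed by explicit bounds: the
four `j`-invariants without core (p. 43; `log(q^∀) ≤ 12`), `h^{1/2} < ξ_prm` (p. 44), the `H_K` of
`FullGaloisImage` (the (P4) step, p. 45), the (P5) case `h ≤ 12·B_K + 81·δ²` (p. 46: "`h ≈ log(q^{∤2}) ≤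
h^{1/2}·log(l)` … implies that `h^{1/4}`, hence `h` itself, is bounded" — here with the elementary bound
`log(l) ≤ 17 + 2δ + 8·h^{1/4}` in place of the printed `16·δ^{1/4}·h^{3/4}`, any polynomial bound in `d` being
absorbed by `d^{4+ε_d}`), and `ε_E > 1` (p. 47, `h < (16/ε_d)³·(60δ)^{4+ε_d}`). Universal constant:
`H_unif := 2^140 ≥ 16³·60⁵·(2^12·3^3·5)⁵ + 81·(2^12·3^3·5)²`; `H_K := ξ_prm² + 12·B_K + H_K^{Gal} + 13`;
`C_K := 40·η_prm + 2·B_K` (p. 47).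

TAKES NO SIDE on [IUTchIII] Cor. 3.12: it enters only through the hypothesis `Thm110Legendre`, by name;
typed ≠ discharged. Deliberately NOT here: the discharge of `FullGaloisImage`; Cor. 2.2 (iii)
(`Corollary22PartIII*.lean`); Cor. 2.3 (`Corollary23*.lean`).
-/

noncomputable section

namespace Literature.IUT.LogVolume

namespace Cor22

open NumberField IsDedekindDomain Real Polynomial Finset
open Literature.NumberTheory.DiophantineGeometry.GenEll

/-! ## Real arithmetic of the exclusions -/

/-- `δ = 2^12·3^3·5·d ≥ 552960` for `d ≥ 1`. [claim: Mochizuki2012, status: disputed] -/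
theorem delta_ge {d : ℕ} (hd : 1 ≤ d) : 552960 ≤ delta d := by
  unfold delta
  have : (1 : ℝ) ≤ d := by exact_mod_cast hd
  nlinarith

/-- "`δ ≥ 2`" (p. 45). [claim: Mochizuki2012, status: disputed] -/
theorem two_le_delta {d : ℕ} (hd : 1 ≤ d) : 2 ≤ delta d := le_trans (by norm_num) (delta_ge hd)

/-- (P1) gives "`l ≤ 20·δ²·h²`" (p. 45), via `log(2δ·h) ≤ 2δ·h` (Prop. 2.1 (i)) and `h ≥ 1`; here with
`s = h^{1/2}`. [claim: Mochizuki2012, status: disputed] -/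
theorem l_le_of_P1 {s δ l : ℝ} (hs : 5 ≤ s) (hδ : 2 ≤ δ)
    (h : l ≤ 10 * δ * s * Real.log (2 * δ * s ^ 2)) : l ≤ 20 * δ ^ 2 * s ^ 4 := by
  have hs0 : 0 < s := by linarith
  have hδ0 : 0 < δ := by linarith
  have hlog : Real.log (2 * δ * s ^ 2) ≤ 2 * δ * s ^ 2 := Real.log_le_self (by positivity)
  have h1 : 10 * δ * s * Real.log (2 * δ * s ^ 2) ≤ 10 * δ * s * (2 * δ * s ^ 2) :=
    mul_le_mul_of_nonneg_left hlog (by positivity)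
  have hs1 : s ^ 3 ≤ s ^ 4 := by nlinarith [pow_pos hs0 3]
  nlinarith [pow_pos hs0 3, pow_pos hδ0 2]

/-- The (P5) exclusion (p. 46): if `𝕍^bad_mod = ∅` then "`h ≈ log(q^{∤2}) ≤ h^{1/2}·log(l)` … an inequality
which implies that `h^{1/4}`, hence `h` itself, is bounded" — explicitly: from `h ≤ 6·B_K + h^{1/2}·log(l)`,
`5 ≤ l ≤ 20·δ²·h²`, one gets `h ≤ 12·B_K + 81·δ²` (with `u = h^{1/4}`: `log(l) ≤ 17 + 2δ + 8u`, and either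
`h^{1/2} ≥ 68 + 8δ`, `u ≥ 32`, whence `h ≤ 6B_K + h/2`, or `h^{1/2} < 9δ`). Here `s = h^{1/2}`.
[claim: Mochizuki2012, status: disputed] -/
theorem h_le_of_no_bad {s δ B L : ℝ} (hs : 5 ≤ s) (hδ : 552960 ≤ δ) (hB : 0 ≤ B) (hL5 : 5 ≤ L)
    (hL : L ≤ 20 * δ ^ 2 * s ^ 4) (hmain : s ^ 2 ≤ 6 * B + s * Real.log L) :
    s ^ 2 ≤ 12 * B + 81 * δ ^ 2 := by
  have hs0 : 0 < s := by linarith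
  have hδ0 : 0 < δ := by linarith
  have hL0 : 0 < L := by linarith
  -- `log L ≤ 17 + 2δ + 4 log s`
  have hlogL : Real.log L ≤ 17 + 2 * δ + 4 * Real.log s := by
    have h1 : Real.log L ≤ Real.log (20 * δ ^ 2 * s ^ 4) := Real.log_le_log hL0 hL
    have h2 : Real.log (20 * δ ^ 2 * s ^ 4) = Real.log 20 + 2 * Real.log δ + 4 * Real.log s := by
      rw [Real.log_mul (by positivity) (by positivity), Real.log_mul (by norm_num) (by positivity),
        Real.log_pow, Real.log_pow]
      push_cast; ring
    have h20 : Real.log 20 ≤ 19 := by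
      have := Real.log_le_sub_one_of_pos (show (0 : ℝ) < 20 by norm_num); linarith
    have hlδ : Real.log δ ≤ δ - 1 := Real.log_le_sub_one_of_pos hδ0
    linarith
  -- `u = h^{1/4}`
  set u := Real.sqrt s with hu
  have hu2 : u ^ 2 = s := Real.sq_sqrt hs0.le
  have hu0 : 0 < u := Real.sqrt_pos.mpr hs0
  have hlogs : Real.log s = 2 * Real.log u := by rw [← hu2, Real.log_pow]; push_cast; ring
  have hlogu : Real.log u ≤ u := by have := Real.log_le_sub_one_of_pos hu0; linarith
  have hlogL' : Real.log L ≤ 17 + 2 * δ + 8 * u := by linarith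
  have hmain' : s ^ 2 ≤ 6 * B + s * (17 + 2 * δ) + 8 * s * u := by
    have := mul_le_mul_of_nonneg_left hlogL' hs0.le
    nlinarith
  by_cases hbig : 68 + 8 * δ ≤ s ∧ 32 ≤ u
  · obtain ⟨hb1, hb2⟩ := hbig
    -- `s·(17 + 2δ) ≤ s²/4` and `8·s·u ≤ s²/4`
    have e1 : s * (17 + 2 * δ) ≤ s ^ 2 / 4 := by nlinarith
    have e2 : 8 * s * u ≤ s ^ 2 / 4 := by
      have : 8 * u ≤ u ^ 2 / 4 := by nlinarith
      rw [hu2] at this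
      nlinarith
    nlinarith
  · -- `s < 68 + 8δ + 1024 ≤ 9δ`
    have hsmall : s < 9 * δ := by
      rw [not_and_or, not_le, not_le] at hbig
      rcases hbig with h1 | h1
      · linarith
      · have : u ^ 2 < 32 ^ 2 := by nlinarith
        rw [hu2] at this
        linarith
    nlinarith

/-- `ε_d^{−3} ≥ 1` for `0 < ε_d ≤ 1`. [folklore] -/
private theorem one_le_rpow_neg_three {ε : ℝ} (hε0 : 0 < ε) (hε1 : ε ≤ 1) : 1 ≤ ε ^ (-(3 : ℝ)) := by
  rw [Real.rpow_neg hε0.le]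
  exact (one_le_inv₀ (Real.rpow_pos_of_pos hε0 _)).mpr (Real.rpow_le_one hε0.le hε1 (by norm_num))

/-- `d² ≤ d^{4+ε_d}` for `d ≥ 1`, `ε_d > 0`. [folklore] -/
private theorem natCast_sq_le_rpow {d : ℕ} (hd : 1 ≤ d) {ε : ℝ} (hε0 : 0 < ε) : (d : ℝ) ^ 2 ≤ (d : ℝ) ^ (4 + ε) := by
  have hd1 : (1 : ℝ) ≤ d := by exact_mod_cast hd
  calc (d : ℝ) ^ 2 = (d : ℝ) ^ ((2 : ℕ) : ℝ) := (Real.rpow_natCast _ 2).symm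
    _ ≤ (d : ℝ) ^ (4 + ε) := Real.rpow_le_rpow_of_exponent_le hd1 (by push_cast; linarith)

/-- The (P5)-exclusion constant fits the printed shape: `81·δ² ≤ 2^45·ε_d^{−3}·d^{4+ε_d}`. [folklore] -/
private theorem delta_sq_le_shape {d : ℕ} (hd : 1 ≤ d) {ε : ℝ} (hε0 : 0 < ε) (hε1 : ε ≤ 1) :
    81 * delta d ^ 2 ≤ 2 ^ 45 * (ε ^ (-(3 : ℝ)) * (d : ℝ) ^ (4 + ε)) := by
  unfold delta
  have h1 := one_le_rpow_neg_three hε0 hε1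
  have h2 := natCast_sq_le_rpow hd hε0
  have hd0 : (0 : ℝ) ≤ (d : ℝ) ^ 2 := sq_nonneg _
  have h3 : 1 * (d : ℝ) ^ 2 ≤ ε ^ (-(3 : ℝ)) * (d : ℝ) ^ (4 + ε) :=
    mul_le_mul h1 h2 hd0 (le_trans zero_le_one h1)
  calc 81 * (2 ^ 12 * 3 ^ 3 * 5 * (d : ℝ)) ^ 2 = (81 * 552960 ^ 2) * (1 * (d : ℝ) ^ 2) := by ring
    _ ≤ 2 ^ 45 * (1 * (d : ℝ) ^ 2) := by nlinarith
    _ ≤ 2 ^ 45 * (ε ^ (-(3 : ℝ)) * (d : ℝ) ^ (4 + ε)) := by nlinarith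

/-- The `ε_E > 1` exclusion constant fits the printed shape (p. 47 "`h ≤ H_unif·ε_d^{−3}·d^{4+ε_d} + H_K` on
`Exc_d` for some positive real number `H_unif` that is independent of `K_V`"):
`(16/ε_d)³·(60δ)^{4+ε_d} ≤ 2^137·ε_d^{−3}·d^{4+ε_d}`. [claim: Mochizuki2012, status: disputed] -/
theorem epsE_exclusion_le_shape {d : ℕ} (hd : 1 ≤ d) {ε : ℝ} (hε0 : 0 < ε) (hε1 : ε ≤ 1) :
    (16 / ε) ^ (3 : ℝ) * (60 * delta d) ^ (4 + ε) ≤ 2 ^ 137 * (ε ^ (-(3 : ℝ)) * (d : ℝ) ^ (4 + ε)) := by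
  unfold delta
  have hd1 : (1 : ℝ) ≤ d := by exact_mod_cast hd
  have hd0 : (0 : ℝ) ≤ d := by linarith
  have e1 : (16 / ε) ^ (3 : ℝ) = 4096 * ε ^ (-(3 : ℝ)) := by
    rw [Real.div_rpow (by norm_num) hε0.le, Real.rpow_neg hε0.le, div_eq_mul_inv]
    congr 1
    rw [show (3 : ℝ) = ((3 : ℕ) : ℝ) by norm_num, Real.rpow_natCast]; norm_num
  have e2 : (60 * (2 ^ 12 * 3 ^ 3 * 5 * (d : ℝ))) ^ (4 + ε) =
      (33177600 : ℝ) ^ (4 + ε) * (d : ℝ) ^ (4 + ε) := by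
    rw [show (60 * (2 ^ 12 * 3 ^ 3 * 5 * (d : ℝ))) = 33177600 * (d : ℝ) by ring]
    exact Real.mul_rpow (by norm_num) hd0
  have e3 : (33177600 : ℝ) ^ (4 + ε) ≤ 2 ^ 125 := by
    calc (33177600 : ℝ) ^ (4 + ε) ≤ (33177600 : ℝ) ^ (5 : ℝ) :=
          Real.rpow_le_rpow_of_exponent_le (by norm_num) (by linarith)
      _ = (33177600 : ℝ) ^ (5 : ℕ) := by rw [show (5 : ℝ) = ((5 : ℕ) : ℝ) by norm_num, Real.rpow_natCast]
      _ ≤ 2 ^ 125 := by norm_num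
  rw [e1, e2]
  have hdp : 0 ≤ (d : ℝ) ^ (4 + ε) := Real.rpow_nonneg hd0 _
  have hε3 : 0 ≤ ε ^ (-(3 : ℝ)) := Real.rpow_nonneg hε0.le _
  calc 4096 * ε ^ (-(3 : ℝ)) * ((33177600 : ℝ) ^ (4 + ε) * (d : ℝ) ^ (4 + ε))
      ≤ 4096 * ε ^ (-(3 : ℝ)) * (2 ^ 125 * (d : ℝ) ^ (4 + ε)) := by
        have := mul_le_mul_of_nonneg_right e3 hdp
        exact mul_le_mul_of_nonneg_left this (by positivity)
    _ = 2 ^ 137 * (ε ^ (-(3 : ℝ)) * (d : ℝ) ^ (4 + ε)) := by ring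

/-! ## The assembly -/

/-- **[IUTchIV] Corollary 2.2 (ii) (pp. 41–43), PROVED from the two named interfaces** for the compactly
bounded subset `K_V` (support `∋ 2`, (∗^{j-inv})) and any `η_prm` of Prop. 1.6, with `H_unif := 2^140`:
"there exist … `C_K` and `H_K` … such that …: Let `d` be a positive integer, `ε_d` a positive real number
`≤ 1`. … Then there exists a finite subset `Exc_d ⊆ U_X(ℚ̄)^{≤d}` which … contains all points corresponding
to elliptic curves that admit automorphisms of order `> 2`, and satisfies …: The function `log(q^∀(−))` …
is `≤ H_unif·ε_d^{−3}·d^{4+ε_d} + H_K` on `Exc_d`. Let `E_F` be an elliptic curve … `x_E ∈ K_V`, `x_E ∉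
Exc_d`. … Then [there is a prime `l` such that] (C1) `(log(q^∀))^{1/2} ≤ l ≤ 10δ·(log(q^∀))^{1/2}·
log(2δ·log(q^∀))`; (C2) `(1/6)·log(q) ≤ (1/6)·log(q^{∤2}) ≤ (1/6)·log(q^∀) ≤ (1 + ε_E)·(log-diff_X(x_E) +
log-cond_D(x_E)) + C_K`." The proof is the printed one (pp. 43–48), see the module docstring; the disputed
Theorem 1.10 enters only through `h110`. [claim: Mochizuki2012, status: disputed] -/
theorem partII_of_thm110Legendre (h110 : Thm110Legendre) (hFG : FullGaloisImage) {η : ℝ}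
    (hη : IsEtaPrm η) (D : CBData) (hD : Hypotheses D) : PartII D (2 ^ 140) := by
  classical
  -- the constants delivered by Cor. 2.2 (i): `B_K` (p. 47) and the height comparison for Northcott
  obtain ⟨h12, h23, h3⟩ := partI_holds D hD
  obtain ⟨B₀, hB₀⟩ := bdEquiv_iff_abs.mp h12
  set B₁ : ℝ := max B₀ 0 with hB₁def
  have hB₁0 : 0 ≤ B₁ := le_max_right _ _
  have hB₁ : ∀ P ∈ D.toSet, |1 / 6 * logQNotTwo P - 1 / 6 * logQForall P| ≤ B₁ := fun P hP => by
    have hx : |1 / 6 * logQNotTwo P - 1 / 6 * logQForall P| ≤ B₀ := hB₀ P hP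
    exact hx.trans (le_max_left _ _)
  obtain ⟨C₀, hC₀⟩ := (h3.symm.trans h23.symm).bdLe
  -- the `H_K` of the classical Galois-image input (the (P4) step, pp. 45–46); `ξ_prm`; `η_prm > 0`
  obtain ⟨G₀, hG₀⟩ := hFG D hD
  set G : ℝ := max G₀ 0 with hGdef
  have hG0 : 0 ≤ G := le_max_right _ _
  obtain ⟨ξ, hξ⟩ := exists_isXiPrm
  have hξ5 : 5 ≤ ξ := hξ.1
  have hη0 : 0 < η := hη.1
  -- `C_K := 40·η_prm + 2·B_K`, `H_K`
  set HK : ℝ := ξ ^ 2 + 12 * B₁ + G + 13 with hHKdef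
  have hHK0 : 0 < HK := by positivity
  refine ⟨CK η B₁, HK, by unfold CK; positivity, hHK0, ?_⟩
  intro d hd εd hεd0 hεd1
  -- the exceptional set
  set X : ℝ := εd ^ (-(3 : ℝ)) * (d : ℝ) ^ (4 + εd) with hXdef
  have hX0 : 0 ≤ X := mul_nonneg (Real.rpow_nonneg hεd0.le _) (Real.rpow_nonneg (Nat.cast_nonneg _) _)
  set Bd : ℝ := 2 ^ 140 * X + HK with hBddef
  have hBd0 : 0 ≤ Bd := by positivity
  have hBdX : 0 ≤ 2 ^ 140 * X := by positivity
  have hξ2 : (25 : ℝ) ≤ ξ ^ 2 := by nlinarith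
  have hBd1 : ξ ^ 2 ≤ Bd := by linarith
  have hBd2 : G < Bd := by linarith
  have hBd3 : 12 * B₁ + 81 * delta d ^ 2 ≤ Bd := by
    have := delta_sq_le_shape hd hεd0 hεd1
    nlinarith
  have hBd4 : (16 / εd) ^ (3 : ℝ) * (60 * delta d) ^ (4 + εd) ≤ Bd := by
    have := epsE_exclusion_le_shape hd hεd0 hεd1
    nlinarith
  have hBd5 : 12 ≤ Bd := by linarith
  have hX1 : 1 ≤ X := by
    have h1 := one_le_rpow_neg_three hεd0 hεd1
    have h2 : (1 : ℝ) ≤ (d : ℝ) ^ (4 + εd) :=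
      Real.one_le_rpow (by exact_mod_cast hd) (by linarith)
    nlinarith
  have hBd6 : 49 < Bd := by nlinarith
  refine ⟨{P | P ∈ D.toSet ∩ UPle d ∧ logQForall P ≤ Bd}, ?_, ?_, ?_, ?_, ?_⟩
  · -- finiteness: Northcott ([GenEll] Prop. 1.4 (iv)) through (i) `ht ≤ (1/6)·log(q^∀) + C₀` on `K_V`
    refine (northcott_UPle_holds d (1 / 6 * Bd + C₀)).mono ?_
    rintro P ⟨⟨hPD, hPd⟩, hPB⟩
    refine ⟨hPd, ?_⟩
    have hx : NFPoint.ht P - 1 / 6 * logQForall P ≤ C₀ := hC₀ P hPD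
    linarith
  · rintro P ⟨⟨_, hPd⟩, _⟩; exact hPd
  · -- `j ∈ {0, 1728}`: `log(q^∀) = 0`
    rintro P hP hj
    exact ⟨hP, by rw [logQForall_eq_zero_of_jInv_zero_or_1728 hj]; exact hBd0⟩
  · rintro P ⟨_, hPB⟩
    show logQForall P ≤ 2 ^ 140 * εd ^ (-(3 : ℝ)) * (d : ℝ) ^ (4 + εd) + HK
    rw [mul_assoc]; exact hPB
  -- the main case: `x_E ∈ K_V ∩ U_X(ℚ̄)^{≤d}`, `x_E ∉ Exc_d`
  rintro P ⟨hPD, hPd⟩ hPexc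
  have hPU : P ∈ UP := hPd.1
  have hPdeg : P.degree ≤ d := hPd.2
  have hInU : P.InU := hPU.1
  set h : ℝ := logQForall P with hhdef
  have hgt : Bd < h := by
    by_contra hle
    exact hPexc ⟨⟨hPD, hPd⟩, not_lt.mp hle⟩
  have hh0 : 0 ≤ h := logQAvoid_nonneg P ∅
  set s : ℝ := Real.sqrt h with hsdef
  have hs2 : s ^ 2 = h := Real.sq_sqrt hh0
  have hξs : ξ ≤ s := by
    have h1 : Real.sqrt (ξ ^ 2) ≤ Real.sqrt h := Real.sqrt_le_sqrt (by linarith)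
    rwa [Real.sqrt_sq (by linarith)] at h1
  have h5s : 5 ≤ s := le_trans hξ5 hξs
  have hδ2 := two_le_delta hd
  have hδ := delta_ge hd
  have hdδ : (P.degree : ℝ) ≤ delta d := by
    have : (P.degree : ℝ) ≤ d := by exact_mod_cast hPdeg
    unfold delta; nlinarith
  -- the curves without `F`-core are in `Exc_d` (p. 43): `log(q^∀) ≤ 12 ≤ B_d` there
  have hcore : AdmitsCore P := by
    by_contra hno
    have := logQForall_le_of_not_admitsCore hno
    linarith
  -- the prime `l` of (P1), (P2), (P3) (pp. 44–45)
  have hprime : ∃ l : ℕ, l.Prime ∧ Real.sqrt h ≤ l ∧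
      (l : ℝ) ≤ 10 * delta d * Real.sqrt h * Real.log (2 * delta d * h) ∧
      (∀ v ∈ badPlaces P, (-(ord P.F v (jInv P.x))).toNat ≠ 0 → ¬ l ∣ (-(ord P.F v (jInv P.x))).toNat) ∧
      (∀ v ∈ badPlaces P, residueChar P.F v = l →
        (((-(ord P.F v (jInv P.x))).toNat : ℕ) : ℝ) < Real.sqrt h) :=
    PrimeChoiceData.exists_prime_P1_P2_P3
      { ι := HeightOneSpectrum (𝓞 P.F), instDecEq := inferInstance, V := badPlaces P,
        hv := fun v => (-(ord P.F v (jInv P.x))).toNat, fv := resDeg P.F,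
        one_le_fv := fun v _ => Nat.one_le_iff_ne_zero.mpr (resDeg_ne_zero P.F v),
        pv := residueChar P.F, pv_prime := fun v _ => residueChar_prime P.F v,
        d := P.degree, one_le_d := P.degree_pos, δ := delta d, two_le_δ := hδ2, d_le_δ := hdδ,
        h := h, h_def := degree_mul_logQForall_eq_sum P, ξ := ξ, isXiPrm := hξ, ξ_le_sqrt := hξs }
  obtain ⟨l, hlp, hP1lo, hP1hi, hP2, hP3⟩ := hprime
  haveI : Fact l.Prime := ⟨hlp⟩
  -- `l ≥ h^{1/2} > 7` (so `l ≥ 7`: both the `5 ≤ l` of [IUTchI] Def. 3.1 (c) and the `7 ≤ l` form of the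
  -- classical Galois-image input are available; `l ≠ 5` as on p. 22)
  have h7s : 7 < s := by
    rw [hsdef, Real.lt_sqrt (by norm_num)]
    linarith
  have h7l : 7 ≤ l := by
    have : (7 : ℝ) ≤ l := le_trans h7s.le hP1lo
    exact_mod_cast this
  have h5l : 5 ≤ l := le_trans (by norm_num) h7l
  have hl5 : (5 : ℝ) ≤ l := by exact_mod_cast h5l
  have hP2' : CondP2 P l := condP2_of_toNat hP2
  -- consequences of (P3) and (i) (p. 47): `log(q^{∤2}) − log(q) ≤ h^{1/2}·log(l)`, `h − log(q^{∤2}) ≤ 6·B_K`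
  have hQ1 : logQNotTwo P - logQAvoid P {2, l} ≤ s * Real.log l := by
    have := logQAvoid_sub_insert_le P {2} hlp (Real.sqrt_nonneg h) (fun v hv hlv =>
      (hP3 v hv ((mem_placesOver_iff_residueChar v).mp (mem_placesOver_of_natCast_mem l v hlv))).le)
    rwa [Finset.pair_comm] at this
  have hQ2 : h - logQNotTwo P ≤ 6 * B₁ := by
    have := (abs_le.mp (hB₁ P hPD)).1
    linarith
  have hq12 : logQAvoid P {2, l} ≤ logQNotTwo P :=
    logQAvoid_anti P (Finset.singleton_subset_iff.mpr (Finset.mem_insert_self 2 {l}))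
  have hq2h : logQNotTwo P ≤ h := logQAvoid_anti P (Finset.empty_subset _)
  -- (P5): `𝕍^bad_mod ≠ ∅` (else `h ≤ 12·B_K + 81·δ² ≤ B_d < h`)
  have hP5 : CondP5 P l := by
    by_contra hno
    have hq0 := logQAvoid_pair_eq_zero_of_not_condP5 hno
    have hL : (l : ℝ) ≤ 20 * delta d ^ 2 * s ^ 4 := l_le_of_P1 h5s hδ2 (by rw [hs2]; exact hP1hi)
    have hmain : s ^ 2 ≤ 6 * B₁ + s * Real.log l := by rw [hs2]; linarith
    have := h_le_of_no_bad h5s hδ hB₁0 hl5 hL hmain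
    rw [hs2] at this
    linarith
  -- (P4) ⇒ (P6): the classical Galois-image input (pp. 45–46), applicable since `h > H_K ≥ G₀`
  have hP6 : CondP6 P l := hG₀ P hPD hPU l hlp (by omega) hP2' hP5 (by linarith [le_max_left G₀ 0])
  -- (P7) + Theorem 1.10 (p. 46): the HYPOTHESIS
  have hdisp : Display P l η := h110 η hη P hPU l hlp (by omega) hcore hP2' hP5 hP6
  -- the arithmetic pp. 46–48 (`Corollary22Arithmetic.lean`), with `d*_mod` in the rôle of `e*_mod`
  let A : Data :=
    { s := s, five_le_s := h5s, δ := delta d, two_le_δ := hδ2, l := l, P1lo := hP1lo,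
      P1hi := by rw [hs2]; exact hP1hi,
      L := P.logDiff + logCondAvoid P {2, l},
      L_nonneg := add_nonneg P.logDiff_nonneg (logCondAvoid_nonneg P _),
      η := η, η_nonneg := hη0.le, B := B₁, B_nonneg := hB₁0,
      logq := logQAvoid P {2, l}, logq2 := logQNotTwo P,
      dmod := dmod P, dmod_nonneg := Nat.cast_nonneg _, twenty_dmod_le := twenty_dmod_le P hPdeg,
      estar := 2 ^ 12 * 3 ^ 3 * 5 * (dmod P : ℝ), estar_nonneg := by positivity,
      estar_le := dstar_le_delta P hPdeg,
      disp := hdisp,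
      Q1 := by linarith,
      Q2 := by rw [hs2]; linarith }
  by_cases hε : epsE (delta d) s ≤ 1
  · have hC2 : 1 / 6 * logQAvoid P {2, l} ≤ 1 / 6 * logQNotTwo P ∧ 1 / 6 * logQNotTwo P ≤ 1 / 6 * s ^ 2 ∧
        1 / 6 * s ^ 2 ≤ (1 + epsE (delta d) s) * (P.logDiff + P.logCond) + CK η B₁ :=
      A.condition_C2 hε (logDiffTpd := P.logDiff) (logCondTpd := logCondAvoid P {2, l}) rfl rfl
        (logCondAvoid_le_logCond P hInU _) hq12 (by rw [hs2]; exact hq2h)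
    obtain ⟨c1, c2, c3⟩ := hC2
    have heps : epsilonE d P = epsE (delta d) s := by
      unfold epsilonE epsE
      rw [← hhdef, ← hsdef, hs2]
      ring
    refine ⟨l, hlp, h5l, hP1lo, hP1hi, c1, ?_, ?_⟩
    · rw [hs2] at c2; exact c2
    · rw [heps, ← hhdef, ← hs2]; exact c3
  · -- `ε_E > 1`: excluded (p. 47), `h < (16/ε_d)³·(60δ)^{4+ε_d} ≤ B_d < h`
    exfalso
    rw [not_le] at hε
    have hlt : s ^ 2 < (16 / εd) ^ (3 : ℝ) * (60 * delta d) ^ (4 + εd) := A.h_lt_of_one_lt_epsE hε hεd0 hεd1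
    rw [hs2] at hlt
    linarith

/-- **[IUTchIV] Corollary 2.2 (ii), uniform form** ("`H_unif` … independent of `K_V`"): from the two named
interfaces, `∃ H_II, ∀ K_V (hypotheses of Cor. 2.2), PartII K_V H_II` — the statement of the route crux
`ThetaPartII` (Summits/ABC/ABC/Theses/IUTThetaPilot). [claim: Mochizuki2012, status: disputed] -/
theorem exists_partII_of_thm110Legendre (h110 : Thm110Legendre) (hFG : FullGaloisImage) :
    ∃ HII : ℝ, ∀ D : CBData, Hypotheses D → PartII D HII := by
  obtain ⟨η, hη⟩ := exists_isEtaPrm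
  exact ⟨2 ^ 140, fun D hD => partII_of_thm110Legendre h110 hFG hη D hD⟩

/-- **[IUTchIV] Corollary 2.2 from the two named interfaces** ("there exists `H_unif` … such that for
every `K_V` … (i), (ii), (iii) hold"): (i) and (iii) are PROVED in the tree unconditionally (`partI_holds`,
`Corollary22PartIII*.lean` via `exists_corollary22_of_partII`), (ii) by `partII_of_thm110Legendre`. The
disputed Theorem 1.10 enters only through `Thm110Legendre`. [claim: Mochizuki2012, status: disputed] -/
theorem exists_corollary22_of_thm110Legendre (h110 : Thm110Legendre) (hFG : FullGaloisImage) :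
    ∃ Hunif : ℝ, Corollary22 Hunif := by
  obtain ⟨η, hη⟩ := exists_isEtaPrm
  exact exists_corollary22_of_partII fun D hD => partII_of_thm110Legendre h110 hFG hη D hD

end Cor22

end Literature.IUT.LogVolume

end
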